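import Summits.AtomisticToContinuum.BoseEinsteinCondensation.Theses.BECCutLineWeakDisorder
import Literature.MathematicalPhysics.QuantumManyBody.GroundState
import Literature.MathematicalPhysics.QuantumManyBody.BoseGasThermodynamicLimitRuelle
import Literature.MathematicalPhysics.QuantumManyBody.JelliumBoseGasProofs
import HarnessLib

/-!
# `GroundStateRigidity` (crux stmt-AtomisticToContinuum-9072): the hypotheses FINITE RANGE and
# LOW DENSITY are load-bearing (negative-side support, refuter cdisprove seat, 2026-08-16)

`GroundStateRigidity` (route `BECCutLineWeakDisorder`, shared verbatim by 8 routes) claims: for every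
repulsive finite-range `v` there is `ρ₀ > 0` such that for `0 < ρ < ρ₀`, all large `N` and every `η > 0`
some `δ > 0` makes any two `δ`-near-minimisers of the Dirichlet energy in the box of side `(N/ρ)^{1/3}`
`η`-close in `L²` up to a constant phase.

Recorded here, sorry-free:

* `not_rigid_of_groundStateEnergy_eq_top` — the MECHANISM: if `E₀(N, L) = ⊤` (`N ≥ 1`, `L > 0`) the
  rigidity conclusion at `(v, N, L)` is FALSE (not vacuous): every trial state is a near-minimiser, and a
  state of the half box and its translate are disjointly supported, at squared distance `2` for every
  phase.  So every proof of the crux must show `E₀ < ⊤` eventually (hard cores must fit at `ρ < ρ₀`).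
* `groundStateRigidity_false_without_finiteRange` — dropping the finite-range clause of
  `IsRepulsiveFiniteRange` (keeping measurability) the statement is false: `v ≡ ⊤` has `E₀ = ⊤` for all
  `N ≥ 2`.
* `groundStateRigidity_false_at_all_densities` — replacing `∃ ρ₀, ∀ ρ < ρ₀` by `∀ ρ > 0` the statement is
  false for an ADMISSIBLE `v`: unit hard spheres `⊤·1_{[0,1]}` at `ρ = 64` have `E₀(N, (N/64)^{1/3}) = ⊤`
  for every `N ≥ 64` (pigeonhole in cells of side `1/2`).

Moral for provers: the dilute regime enters twice — to make the hard-core configuration space nonempty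
at all, and (the open part, not touched here) to make its energy-minimising component unique.  This file
does NOT refute the crux.
-/

noncomputable section

namespace Summit.AtomisticToContinuum.BoseEinsteinCondensation.Theorems.GroundStateRigidity.Negative

open Literature.MathematicalPhysics.QuantumManyBody.BoseGas
open Summit.AtomisticToContinuum.BoseEinsteinCondensation.Theses.BECCutLineWeakDisorder
open MeasureTheory Filter Metric
open scoped ENNReal NNReal Topology

/-! ## Bookkeeping on the thermodynamic box -/

/-- `L³ = N/ρ` for the thermodynamic box. -/
theorem sideLength_pow_three {ρ : ℝ} (hρ : 0 < ρ) {N : ℕ} (hN : 0 < N) :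
    sideLength ρ N ^ 3 = N / ρ := by
  have h := div_sideLength_pow_three hρ hN
  have hL : 0 < sideLength ρ N := by
    unfold sideLength
    exact Real.rpow_pos_of_pos (div_pos (by exact_mod_cast hN) hρ) _
  field_simp at h
  field_simp
  linarith

/-! ## Disjointly supported pairs of trial states defeat rigidity -/

/-- Two disjointly supported normalised states are at squared `L²`-distance `2`, whatever the phase. -/
theorem lintegral_sub_mul_sq_eq_two {N : ℕ} {L : ℝ} (Ψ Φ : TrialState N L)
    (h : ∀ X, Ψ.ψ X = 0 ∨ Φ.ψ X = 0) {c : ℂ} (hc : ‖c‖ = 1) :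
    ∫⁻ X, (‖Ψ.ψ X - c * Φ.ψ X‖₊ : ℝ≥0∞) ^ 2 = 2 := by
  have hpt : ∀ X, (‖Ψ.ψ X - c * Φ.ψ X‖₊ : ℝ≥0∞) ^ 2 =
      (‖Ψ.ψ X‖₊ : ℝ≥0∞) ^ 2 + (‖Φ.ψ X‖₊ : ℝ≥0∞) ^ 2 := by
    intro X
    rcases h X with h0 | h0
    · rw [h0, zero_sub, nnnorm_neg, nnnorm_mul, ENNReal.coe_mul,
        coe_nnnorm_eq_one_of_norm_eq_one hc, one_mul]
      simp
    · rw [h0, mul_zero, sub_zero]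
      simp
  simp_rw [hpt]
  have hm : Measurable fun X => (‖Ψ.ψ X‖₊ : ℝ≥0∞) ^ 2 :=
    (Ψ.contDiff.continuous.measurable.nnnorm.coe_nnreal_ennreal).pow_const 2
  rw [lintegral_add_left hm, Ψ.norm_eq, Φ.norm_eq]
  norm_num

/-- **Two disjointly supported trial states exist** in every box (`N ≥ 1`, `L > 0`): a state of the
half box `Λ_{L/2}` and its translate by `(L/2, L/2, L/2)`. -/
theorem exists_disjoint_trialStates {N : ℕ} (hN : 0 < N) {L : ℝ} (hL : 0 < L) :
    ∃ Ψ Φ : TrialState N L, ∀ X, Ψ.ψ X = 0 ∨ Φ.ψ X = 0 := by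
  obtain ⟨Ψ₀⟩ := TrialState.nonempty hN (half_pos hL)
  let a : Space := WithLp.toLp 2 fun _ : Fin 3 => L / 2
  let A := Ψ₀.toSupported.translate a
  have hsub : {x : Space | x - a ∈ box (L / 2)} ⊆ box L := by
    intro x hx k
    have hk := hx k
    simp only [a, PiLp.sub_apply, Set.mem_Ioo] at hk
    constructor <;> linarith [hk.1, hk.2]
  refine ⟨Ψ₀.enlarge (by linarith), (A.mono hsub).toTrialState, fun X => ?_⟩
  by_contra hX
  push Not at hX
  obtain ⟨h1, h2⟩ := hX
  have hX1 : X ∈ boxN N (L / 2) := by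
    by_contra hc
    exact h1 (Ψ₀.eq_zero X hc)
  have hX2 : (X - fun _ => a) ∈ boxN N (L / 2) := by
    by_contra hc
    exact h2 (Ψ₀.eq_zero _ hc)
  have k0 : Fin 3 := 0
  have i0 : Fin N := ⟨0, hN⟩
  have hlt := (hX1 i0 k0).2
  have hgt := (hX2 i0 k0).1
  simp only [Pi.sub_apply, PiLp.sub_apply, a] at hgt
  linarith

/-- **Infinite ground-state energy kills rigidity** (`N ≥ 1`, `L > 0`): with `E₀ = ⊤` every trial state
is a near-minimiser at every slack, so two disjointly supported ones are, and no phase brings them within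
`η = 1` of each other. -/
theorem not_rigid_of_groundStateEnergy_eq_top {v : ℝ → ℝ≥0∞} {N : ℕ} (hN : 0 < N) {L : ℝ}
    (hL : 0 < L) (hE : groundStateEnergy v N L = ⊤) :
    ¬ (∀ η : ℝ, 0 < η → ∃ δ : ℝ≥0∞, 0 < δ ∧ ∀ Ψ Φ : TrialState N L,
        energy v Ψ ≤ groundStateEnergy v N L + δ → energy v Φ ≤ groundStateEnergy v N L + δ →
        ∃ c : ℂ, ‖c‖ = 1 ∧ ∫⁻ X, (‖Ψ.ψ X - c * Φ.ψ X‖₊ : ℝ≥0∞) ^ 2 ≤ ENNReal.ofReal η) := by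
  intro hR
  obtain ⟨δ, -, hΨΦ⟩ := hR 1 one_pos
  obtain ⟨Ψ, Φ, hdisj⟩ := exists_disjoint_trialStates hN hL
  obtain ⟨c, hc, hle⟩ := hΨΦ Ψ Φ (by rw [hE, top_add]; exact le_top)
    (by rw [hE, top_add]; exact le_top)
  rw [lintegral_sub_mul_sq_eq_two Ψ Φ hdisj hc, ENNReal.ofReal_one] at hle
  exact absurd hle (by norm_num)

/-- An interaction that is `⊤` wherever the state lives makes the energy infinite. -/
theorem energy_eq_top_of_interaction_eq_top {N : ℕ} {L : ℝ} (v : ℝ → ℝ≥0∞) (Ψ : TrialState N L)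
    (h : ∀ X, Ψ.ψ X ≠ 0 → interaction v X = ⊤) : energy v Ψ = ⊤ := by
  have hm : Measurable fun X => (‖Ψ.ψ X‖₊ : ℝ≥0∞) ^ 2 :=
    (Ψ.contDiff.continuous.measurable.nnnorm.coe_nnreal_ennreal).pow_const 2
  have hpt : ∀ X, interaction v X * (‖Ψ.ψ X‖₊ : ℝ≥0∞) ^ 2 = ⊤ * (‖Ψ.ψ X‖₊ : ℝ≥0∞) ^ 2 := by
    intro X
    by_cases hX : Ψ.ψ X = 0
    · simp [hX]
    · rw [h X hX]
  apply eq_top_iff.2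
  calc (⊤ : ℝ≥0∞) = ⊤ * ∫⁻ X, (‖Ψ.ψ X‖₊ : ℝ≥0∞) ^ 2 := by rw [Ψ.norm_eq, mul_one]
    _ = ∫⁻ X, interaction v X * (‖Ψ.ψ X‖₊ : ℝ≥0∞) ^ 2 := by
        rw [← lintegral_const_mul _ hm]
        exact lintegral_congr fun X => (hpt X).symm
    _ ≤ energy v Ψ := lintegral_mono fun X => le_add_self

/-- If every trial state has infinite energy, `E₀ = ⊤`. -/
theorem groundStateEnergy_eq_top_of_forall {v : ℝ → ℝ≥0∞} {N : ℕ} {L : ℝ}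
    (h : ∀ Ψ : TrialState N L, energy v Ψ = ⊤) : groundStateEnergy v N L = ⊤ := by
  unfold groundStateEnergy
  exact iInf_eq_top.2 h

/-! ## Finite range is load-bearing -/

/-- For `v ≡ ⊤` and `N ≥ 2` the interaction is `⊤` at every configuration. -/
theorem interaction_top_eq_top {N : ℕ} (hN : 2 ≤ N) (X : Config N) :
    interaction (fun _ => (⊤ : ℝ≥0∞)) X = ⊤ := by
  unfold interaction
  rw [ENNReal.sum_eq_top]
  refine ⟨⟨0, by omega⟩, Finset.mem_univ _, ?_⟩
  rw [ENNReal.sum_eq_top]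
  exact ⟨⟨1, by omega⟩, by simp [Finset.mem_filter, Fin.lt_def], rfl⟩

/-- **`GroundStateRigidity` is false without the finite-range hypothesis**: the crux with
`IsRepulsiveFiniteRange v` weakened to `Measurable v` fails at `v ≡ ⊤` (`E₀ = ⊤` for all `N ≥ 2`). -/
theorem groundStateRigidity_false_without_finiteRange :
    ¬ (∀ v : ℝ → ℝ≥0∞, Measurable v → ∃ ρ₀ : ℝ, 0 < ρ₀ ∧ ∀ ρ : ℝ, 0 < ρ → ρ < ρ₀ →
        ∀ᶠ N : ℕ in atTop, ∀ η : ℝ, 0 < η → ∃ δ : ℝ≥0∞, 0 < δ ∧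
          ∀ Ψ Φ : TrialState N (sideLength ρ N),
            energy v Ψ ≤ groundStateEnergy v N (sideLength ρ N) + δ →
            energy v Φ ≤ groundStateEnergy v N (sideLength ρ N) + δ →
            ∃ c : ℂ, ‖c‖ = 1 ∧ ∫⁻ X, (‖Ψ.ψ X - c * Φ.ψ X‖₊ : ℝ≥0∞) ^ 2 ≤ ENNReal.ofReal η) := by
  intro h
  obtain ⟨ρ₀, hρ₀, h⟩ := h (fun _ => ⊤) measurable_const
  have h' := h (ρ₀ / 2) (half_pos hρ₀) (half_lt_self hρ₀)
  obtain ⟨N, hN2, hR⟩ := ((eventually_ge_atTop 2).and h').exists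
  have hL : 0 < sideLength (ρ₀ / 2) N := by
    unfold sideLength
    exact Real.rpow_pos_of_pos (div_pos (by exact_mod_cast (show 0 < N by omega)) (half_pos hρ₀)) _
  refine not_rigid_of_groundStateEnergy_eq_top (v := fun _ => ⊤) (by omega) hL ?_ hR
  exact groundStateEnergy_eq_top_of_forall fun Ψ =>
    energy_eq_top_of_interaction_eq_top _ Ψ fun X _ => interaction_top_eq_top hN2 X

/-! ## Low density is load-bearing: unit hard spheres at density `64` -/

/-- Unit hard spheres `⊤ · 1_{[0,1]}` are an admissible (measurable, range-`1`) interaction. -/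
theorem isRepulsiveFiniteRange_hardSphere :
    IsRepulsiveFiniteRange (fun r : ℝ => if r ≤ 1 then (⊤ : ℝ≥0∞) else 0) := by
  refine ⟨Measurable.ite measurableSet_Iic measurable_const measurable_const, 1, fun r hr => ?_⟩
  simp [not_le.2 hr]

/-- Equal `⌊2a⌋₊ = ⌊2b⌋₊` for `a, b ≥ 0` forces `|a - b| < 1/2`. -/
theorem abs_sub_lt_half_of_floor_eq {a b : ℝ} (ha : 0 ≤ a) (hb : 0 ≤ b)
    (h : ⌊2 * a⌋₊ = ⌊2 * b⌋₊) : |a - b| < 1 / 2 := by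
  have ha1 := Nat.floor_le (by linarith : 0 ≤ 2 * a)
  have ha2 := Nat.lt_floor_add_one (2 * a)
  have hb1 := Nat.floor_le (by linarith : 0 ≤ 2 * b)
  have hb2 := Nat.lt_floor_add_one (2 * b)
  rw [h] at ha1 ha2
  rw [abs_sub_lt_iff]
  constructor <;> linarith

/-- **Pigeonhole**: more than `⌈2L⌉₊³` points of `Λ_L` contain two at distance `≤ 1` (cells of side
`1/2` have diameter `√3/2 ≤ 1`). -/
theorem exists_dist_le_one {N : ℕ} {L : ℝ} {X : Config N} (hX : X ∈ boxN N L)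
    (hN : ⌈2 * L⌉₊ ^ 3 < N) : ∃ i j : Fin N, i < j ∧ dist (X i) (X j) ≤ 1 := by
  set K : ℕ := ⌈2 * L⌉₊ with hK
  have hcoord : ∀ (i : Fin N) (k : Fin 3), 0 ≤ X i k ∧ ⌊2 * X i k⌋₊ < K := by
    intro i k
    have h := hX i k
    refine ⟨h.1.le, ?_⟩
    rw [Nat.floor_lt (by linarith [h.1])]
    calc 2 * X i k < 2 * L := by linarith [h.2]
      _ ≤ K := Nat.le_ceil _
  let cell : Fin N → (Fin 3 → Fin K) := fun i k => ⟨⌊2 * X i k⌋₊, (hcoord i k).2⟩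
  have hcard : Fintype.card (Fin 3 → Fin K) < Fintype.card (Fin N) := by
    simpa using hN
  obtain ⟨i, j, hij, hcell⟩ := Fintype.exists_ne_map_eq_of_card_lt cell hcard
  have hclose : ∀ k : Fin 3, dist (X i k) (X j k) ≤ 1 / 2 := by
    intro k
    have hk : ⌊2 * X i k⌋₊ = ⌊2 * X j k⌋₊ := by
      have := congrFun hcell k
      simpa [cell] using this
    rw [Real.dist_eq]
    exact (abs_sub_lt_half_of_floor_eq (hcoord i k).1 (hcoord j k).1 hk).le
  have hdist : dist (X i) (X j) ≤ 1 := by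
    rw [EuclideanSpace.dist_eq]
    have hsum : ∑ k, dist (X i k) (X j k) ^ 2 ≤ 1 := by
      have hk : ∀ k : Fin 3, dist (X i k) (X j k) ^ 2 ≤ (1 / 2) ^ 2 := fun k =>
        pow_le_pow_left₀ dist_nonneg (hclose k) 2
      calc ∑ k, dist (X i k) (X j k) ^ 2 ≤ ∑ _k : Fin 3, (1 / 2 : ℝ) ^ 2 :=
            Finset.sum_le_sum fun k _ => hk k
        _ ≤ 1 := by simp; norm_num
    calc Real.sqrt (∑ k, dist (X i k) (X j k) ^ 2) ≤ Real.sqrt 1 := Real.sqrt_le_sqrt hsum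
      _ = 1 := Real.sqrt_one
  rcases lt_or_gt_of_ne hij with hlt | hlt
  · exact ⟨i, j, hlt, hdist⟩
  · exact ⟨j, i, hlt, by rwa [dist_comm]⟩

/-- Hence `E₀(N, L) = ⊤` for unit hard spheres once `N > ⌈2L⌉₊³`. -/
theorem groundStateEnergy_hardSphere_eq_top {N : ℕ} {L : ℝ} (hN : ⌈2 * L⌉₊ ^ 3 < N) :
    groundStateEnergy (fun r : ℝ => if r ≤ 1 then (⊤ : ℝ≥0∞) else 0) N L = ⊤ := by
  refine groundStateEnergy_eq_top_of_forall fun Ψ => energy_eq_top_of_interaction_eq_top _ Ψ ?_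
  intro X hX
  have hXb : X ∈ boxN N L := by
    by_contra hc
    exact hX (Ψ.eq_zero X hc)
  obtain ⟨i, j, hij, hd⟩ := exists_dist_le_one hXb hN
  unfold interaction
  rw [ENNReal.sum_eq_top]
  refine ⟨i, Finset.mem_univ _, ?_⟩
  rw [ENNReal.sum_eq_top]
  exact ⟨j, by simp [hij], by simp [hd]⟩

/-- Density bookkeeping: at `ρ = 64`, `⌈2L⌉₊³ < N` for all `N ≥ 64` (`L³ = N/64 ≥ 1`,
`⌈2L⌉₊ < 2L + 1 ≤ 3L`, `27 L³ < N`). -/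
theorem ceil_cube_lt {N : ℕ} (hN : 64 ≤ N) : ⌈2 * sideLength 64 N⌉₊ ^ 3 < N := by
  set L := sideLength 64 N with hLdef
  have hN0 : 0 < N := by omega
  have hL : 0 < L := by
    rw [hLdef]
    unfold sideLength
    exact Real.rpow_pos_of_pos (div_pos (by exact_mod_cast hN0) (by norm_num)) _
  have hL3 : L ^ 3 = N / 64 := sideLength_pow_three (by norm_num) hN0
  have hNr : (64 : ℝ) ≤ N := by exact_mod_cast hN
  have hL1 : 1 ≤ L := by
    by_contra hc
    push Not at hc
    have : L ^ 3 < 1 ^ 3 := pow_lt_pow_left₀ hc hL.le three_ne_zero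
    rw [hL3, one_pow, div_lt_one (by norm_num)] at this
    linarith
  have hceil : (⌈2 * L⌉₊ : ℝ) < 2 * L + 1 := Nat.ceil_lt_add_one (by linarith)
  have h3 : (⌈2 * L⌉₊ : ℝ) < 3 * L := by linarith
  have hcube : ((⌈2 * L⌉₊ : ℕ) : ℝ) ^ 3 < (3 * L) ^ 3 :=
    pow_lt_pow_left₀ h3 (Nat.cast_nonneg _) three_ne_zero
  have hfin : ((⌈2 * L⌉₊ : ℕ) : ℝ) ^ 3 < N := by
    calc ((⌈2 * L⌉₊ : ℕ) : ℝ) ^ 3 < (3 * L) ^ 3 := hcube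
      _ = 27 * (N / 64) := by rw [mul_pow, hL3]; norm_num
      _ ≤ N := by linarith
  exact_mod_cast hfin

/-- **`GroundStateRigidity` is false at all densities**: the crux with `∃ ρ₀ > 0, ∀ ρ < ρ₀` replaced by
`∀ ρ > 0` fails for the admissible unit hard spheres at `ρ = 64` (for every `N ≥ 64`, `E₀ = ⊤`). -/
theorem groundStateRigidity_false_at_all_densities :
    ¬ (∀ v : ℝ → ℝ≥0∞, IsRepulsiveFiniteRange v → ∀ ρ : ℝ, 0 < ρ →
        ∀ᶠ N : ℕ in atTop, ∀ η : ℝ, 0 < η → ∃ δ : ℝ≥0∞, 0 < δ ∧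
          ∀ Ψ Φ : TrialState N (sideLength ρ N),
            energy v Ψ ≤ groundStateEnergy v N (sideLength ρ N) + δ →
            energy v Φ ≤ groundStateEnergy v N (sideLength ρ N) + δ →
            ∃ c : ℂ, ‖c‖ = 1 ∧ ∫⁻ X, (‖Ψ.ψ X - c * Φ.ψ X‖₊ : ℝ≥0∞) ^ 2 ≤ ENNReal.ofReal η) := by
  intro h
  have h' := h _ isRepulsiveFiniteRange_hardSphere 64 (by norm_num)
  obtain ⟨N, hN, hR⟩ := ((eventually_ge_atTop 64).and h').exists
  have hL : 0 < sideLength 64 N := by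
    unfold sideLength
    exact Real.rpow_pos_of_pos (div_pos (by exact_mod_cast (show 0 < N by omega)) (by norm_num)) _
  exact not_rigid_of_groundStateEnergy_eq_top (by omega) hL
    (groundStateEnergy_hardSphere_eq_top (ceil_cube_lt hN)) hR

end Summit.AtomisticToContinuum.BoseEinsteinCondensation.Theorems.GroundStateRigidity.Negative

end
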